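import Literature.LinearAlgebra.TensorNetworks.QTTLaplaceInverse
import Literature.Analysis.Matrix.KroneckerSumExp

/-!
# Laplace-like Kronecker sums as rank-2 tensor trains and the explicit QTT structure of the
# `D`-dimensional Laplace operator (Kazeev–Khoromskij, Lem. 1.1, Cor. 2.3–2.4, Thm. 4.1)

This file continues `Literature.LinearAlgebra.TensorNetworks.QTTLaplace` (Lem. 2.1–2.2 of the cited
paper: the rank-`3`/`4` QTT representations of the one-dimensional Laplacians `Δ_DD^{(d)}`, …) and
`Literature.LinearAlgebra.TensorNetworks.QTTLaplaceInverse` (§3) with the MULTI-DIMENSIONAL part of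
the same paper:

* (TT MATRICES, eq. (2); REM. 0.6) `TensorTrain.ttMatrix T`, the matrix with multi-indices
  `(i₁…i_L), (j₁…j_L)` represented by a train on product legs `ι × ι'` (the QTT matrix `qttMatrix`
  of `QTTLaplace` is its reindexing by the binary coding, `qttMatrix_eq_submatrix_ttMatrix`);
  Kronecker products of families `A₀ ⊗ ⋯ ⊗ A_{L-1}` as matrices on `Fin L → ι` (`kronPi`,
  `kronPi_mul_kronPi`, `kronPi_one`, `reindex_kronPi_two : ⋯ = A 0 ⊗ₖ A 1`) and Rem. 0.6's
  "a tensor product is a concatenated train" in scalar-leg form (`kronTrain`, rank `1 ⋯ 1`,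
  `ttMatrix_kronTrain : ttMatrix (kronTrain A L) = kronPi A`); chains of chains
  (`TensorTrain.chainProd_add`, `TensorTrain.chainProd_mul_eq_chainProd_chainProd`: the `D·d`-site
  chain is the `D`-site chain of the `d`-site block chains — Rem. 1.2 / Lem. 1.3, a QTT
  decomposition read as a TT decomposition with supercores);
* (EQ. (8), LEMMA 1.1) the Laplace-like operator
  `L^{(D)} = Σ_q L₁ ⊗ ⋯ ⊗ L_{q-1} ⊗ M_q ⊗ R_{q+1} ⊗ ⋯ ⊗ R_D` (`laplaceLike Lm M R`,
  `laplaceLike_apply`) and its rank-`2 ⋯ 2` TT representation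
  `[L₁ M₁] ⋈ [L₂ M₂; 0 R₂] ⋈ ⋯ ⋈ [L_{D-1} M_{D-1}; 0 R_{D-1}] ⋈ [M_D; R_D]`: the uniform train
  `laplaceLikeTrain` (`(1,0) ⋈ [L_k M_k; 0 R_k]^{⋈D} ⋈ (0,1)ᵀ`, valid for every `D ≥ 0`), the row
  recursion (9) of the cited proof (`laplaceLikeVec_succ`, `vecMul_chainProd_laplaceLikeCore`: the
  state after `k` cores is `(L₁⊗⋯⊗L_k, L^{(k)})`), `eval_laplaceLikeTrain`,
  `ttMatrix_laplaceLikeTrain : ttMatrix = laplaceLike`, and the `D`-factor form VERBATIM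
  `laplaceLike_eq_first_mul_chainProd_mul_last` (`D = k + 2 ≥ 2`, cores `laplaceLikeFirst`,
  `laplaceLikeCore`, `laplaceLikeLast`);
* (EQ. (3), COROLLARY 2.3) the `D`-dimensional Laplacian
  `Δ^{(d₁…d_D)} = a₁Δ₁ ⊗ I ⊗ ⋯ ⊗ I + ⋯ + I ⊗ ⋯ ⊗ I ⊗ a_DΔ_D` (`laplaceMulti a Δ`,
  `laplaceMulti_apply`; for `D = 2` it is the Kronecker sum `a₀Δ₀ ⊕ a₁Δ₁` of
  `Literature.Analysis.Matrix.KroneckerSumExp`, `reindex_laplaceMulti_two`) and its rank-`2 ⋯ 2`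
  representation by the supercores `[I a_kΔ_k; 0 I]` (`laplaceMultiCore`, `laplaceMultiTrain`,
  `ttMatrix_laplaceMultiTrain : ttMatrix = laplaceMulti`);
* (COROLLARY 2.4) the explicit QTT structure of the three Dirichlet supercores `Δ_k = Δ_DD^{(d)}` in
  terms of the blocks `I, J, J'` of eq. (7) and the rank-`3` core `W = [I J' J; 0 J 0; 0 0 J']` of
  Lem. 2.1 (`lapCore` of `QTTLaplace`): the middle core `[I J' J 0; 0 J 0 0; 0 0 J' 0; 0 0 0 I] =
  diag(W, I)` (`lapSupCore`), the first core `[I J' J 0; 0 0 0 I]` (`supFirst`), the last cores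
  `[I a(2I-J-J'); 0 -aJ; 0 -aJ'; 0 I]` (`supLast`), `[I a(2I-J-J'); 0 -aJ; 0 -aJ']` (`supLast₁`) and
  `[aI aJ' aJ; 0 aJ 0; 0 0 aJ'; ½I -½I -½I]` (`supPenult`); the three displays VERBATIM as identities
  of block entries at the index pair `(m, n)` coded by the digit strings:
  `supFirst_mul_chainProd_mul_supLast` (middle supercore `[I^{⊗d} aΔ_DD^{(d)}; 0 I^{⊗d}]`, `d ≥ 2`),
  `lapFirst_mul_chainProd_mul_supLast₁` (first supercore `[I^{⊗d} aΔ_DD^{(d)}]`, `d ≥ 2`),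
  `supFirst_mul_chainProd_mul_supPenult_mul_lapLast` (last supercore `[aΔ_DD^{(d)}; I^{⊗d}]`, `d ≥ 3`,
  over a field with `2 ≠ 0` — the only place `½` enters; its sweep is `supZ_mulVec_lapCore_mulVec`);
  behind them the supercore automaton `vecMul_chainProd_lapSupCore` (states
  `(x𝟙[m=n], x𝟙[m=n+1], x𝟙[n=m+1], y𝟙[m=n])`: the Laplace channels of Lem. 2.1 and the identity
  channel) and the uniform-form identity `supL_mul_chainProd_mul_supR :
  E · diag(W,I)(i₁,j₁) ⋯ diag(W,I)(i_d,j_d) · B(a) = [𝟙[m=n] aΔ_DD^{(d)}(m,n); 0 𝟙[m=n]]` (every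
  `d ≥ 0`) with the BOND MATRICES `E = [1 0 0 0; 0 0 0 1]` (`supL`) and `B(a) = [1 2a; 0 -a; 0 -a; 0 1]`
  (`supR`): `supFirst = E ⋈ diag(W,I)`, `supLast a = diag(W,I) ⋈ B(a)`, `supLast₁ a = W ⋈ B₁(a)`,
  `supPenult a = diag(W,I) ⋈ Z(a)` (`supFirst_eq`, `supLast_eq`, `supLast₁_eq`, `supPenult_eq`);
* (REM. 1.2 + COR. 2.3 + COR. 2.4: THE ASSEMBLED QTT LAPLACIAN) the uniform rank-`4` train
  `lapMultiTrain a D d` on `D·d` sites `ℓ = k·d + t` (dimension `k`, bit `t`): core `diag(W, I)`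
  inside each dimension and the JUNCTION CORE `supLast a_k ⋈ E` (`lapJunction`, written out in
  `lapJunction_eq`, rank `≤ 2`) at the last site of dimension `k`; the block identity
  `chainProd_lapMultiTrain_block` and the main theorem `eval_lapMultiTrain` /
  `ttMatrix_lapMultiTrain`: for `d ≥ 1` the TT matrix of `lapMultiTrain a D d` is
  `Δ^{(d…d)} = Σ_k I ⊗ ⋯ ⊗ a_kΔ_DD^{(d)} ⊗ ⋯ ⊗ I` (`Δ_DD = tridiag(-1, 2, -1)`, `laplaceDD` of
  `QTTLaplace`), the multi-indices serialised dimension by dimension, most significant bit first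
  (`serialEquiv` of `QuanticsTensorTrain`);
* (THEOREM 4.1, line `Δ_DD^{(d₁…d_D)} : 3 … 3, 2, 4 … 4, 2, … , 2, 4 … 4, 3`) the rank profile of
  that train as bounds on unfolding ranks over a field: `≤ 4` at every bond
  (`rank_unfolding_lapMultiTrain_le`), `≤ 2` across the bond after each junction site
  (`rank_unfolding_lapMultiTrain_junction_le`), `≤ 3` inside the first dimension
  (`rank_unfolding_lapMultiTrain_head_le`) and across the last bond
  (`rank_unfolding_lapMultiTrain_last_le`), from the general devices
  `TensorTrain.rank_unfolding_uniform_le_of_vecMul_chainProd`, `…_of_core_eq_mul`,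
  `…_of_chainProd_mulVec` (a factorisation of the swept boundary row / of a core / of the swept
  boundary column bounds the unfolding rank — the "elimination of dependent QTT blocks" of the
  cited proofs) and `TensorTrain.segProd_uniform`.

Conventions: digit pairs most significant first (`quanticsEquiv`), indices from `0` (the paper's
from `1`), dimensions and sites from `0`; every train is in the uniform form of
`QuanticsTensorTrain` (`TensorTrain.uniform`: one bond dimension, boundary vectors), so the paper's
non-square terminal cores appear as products of the uniform cores with bond matrices / boundary
vectors (`supFirst_eq`, …) and its rank drops as unfolding-rank bounds.  The last core of the first
display of Cor. 2.4 is read as the `4 × 2` core `[I a_k(2I-J-J'); 0 -a_kJ; 0 -a_kJ'; 0 I]` (block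
content as printed; the preprint's typography leaves the column alignment of this core ambiguous,
and this reading is the one for which the identity holds).

Not formalised / honest scope: distinct depths `d_k` per dimension and general mode sizes
`m_k × n_k` (a train here has one leg type: Lem. 1.1 is proved with a common index type `ι × ι'` at
every dimension and the assembled QTT Laplacian for `d₁ = ⋯ = d_D = d`); the outer core product
`•` of Def. 0.5 and the linear-combination / product rules of Rem. 0.6; the general merging formula
(10)–(11); Cor. 2.5–2.7 (the `DN`, `NN` and periodic supercores) and the other lines of Thm. 4.1;
sharpness of the ranks (Rem. 4.2); §5.  Numbering `Def. 0.5`, `Rem. 0.6`, `Lem. 1.1`, `Rem. 1.2`,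
`Lem. 1.3`, `Cor. 2.3`, `Cor. 2.4`, `Thm. 4.1`, `eqs. (2), (3), (7), (8), (9)` follows the Max Planck
Institute MIS Leipzig Preprint 75/2010 version of [KazeevKhoromskij2012].

References: V. A. Kazeev, B. N. Khoromskij, *Low-rank explicit QTT representation of the Laplace
operator and its inverse*, SIAM J. Matrix Anal. Appl. 33 (2012) 742–758, MPI MIS Preprint 75/2010
(`KazeevKhoromskij2012`), §§0–2 and Thm. 4.1; D. S. Bernstein, *Matrix Mathematics* (2009),
Def. 7.2.1 (`Bernstein2009`, the binary Kronecker sum, via `KroneckerSumExp`).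

AI-produced formalisation (H21 engines group, seat eng-quad-2, 2026-08-23); no facts, no axioms
beyond Mathlib's, no `sorry`.
-/

open Matrix Finset
open scoped Kronecker

namespace Literature.LinearAlgebra.TensorNetworks

universe u

/-! ### TT matrices on general legs, chains of chains -/

namespace TensorTrain

variable {K : Type u} [CommSemiring K] {ι ι' σ : Type*} {L : ℕ}

/-- THE TT MATRIX (TT operator) represented by a train `T` on product legs `ι × ι'`: the matrix
with multi-indices `(i₁, …, i_L)`, `(j₁, …, j_L)` and entries
`A((i₁…i_L), (j₁…j_L)) = T((i₁, j₁), …, (i_L, j_L))` — eq. (2) of Kazeev–Khoromskij with general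
mode sizes; the QTT matrix `qttMatrix` is its reindexing by the binary coding (below).
[cite: KazeevKhoromskij2012, eq. (2)] -/
def ttMatrix (T : TensorTrain K (ι × ι') L) : Matrix (Fin L → ι) (Fin L → ι') K :=
  Matrix.of fun i j => T.eval fun r => (i r, j r)

/-- Definitional unfolding of `ttMatrix`.  [cite: KazeevKhoromskij2012, eq. (2)] -/
@[simp] theorem ttMatrix_apply (T : TensorTrain K (ι × ι') L) (i : Fin L → ι) (j : Fin L → ι') :
    T.ttMatrix i j = T.eval fun r => (i r, j r) := rfl

/-- The QTT matrix of a train on `Fin b × Fin b` legs is its TT matrix reindexed by the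
most-significant-first base-`b` coding `quanticsEquiv`.  [cite: KazeevKhoromskij2012, eq. (2)] -/
theorem qttMatrix_eq_submatrix_ttMatrix {b R : ℕ} (T : TensorTrain K (Fin b × Fin b) R) :
    T.qttMatrix = T.ttMatrix.submatrix (quanticsEquiv b R).symm (quanticsEquiv b R).symm := rfl

/-- A chain depends on the cores only through the sites it visits (bookkeeping).
[cite: KazeevKhoromskij2012, Rem. 0.6] -/
theorem chainProd_congr {n : ℕ} {G G' : ℕ → σ → Matrix (Fin n) (Fin n) K} :
    ∀ {k : ℕ} (_ : ∀ ℓ < k, ∀ a, G ℓ a = G' ℓ a) (s : Fin k → σ), chainProd G k s = chainProd G' k s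
  | 0, _, _ => rfl
  | k + 1, h, s => by
      rw [chainProd, chainProd, chainProd_congr (fun ℓ hℓ a => h ℓ (by omega) a) (Fin.init s),
        h k (by omega)]

/-- Relabelling the legs of a chain (bookkeeping).  [cite: KazeevKhoromskij2012, Rem. 0.6] -/
theorem chainProd_comp {τ : Type*} {n : ℕ} (G : ℕ → σ → Matrix (Fin n) (Fin n) K) (φ : τ → σ) :
    ∀ (k : ℕ) (s : Fin k → τ),
      chainProd (fun ℓ c => G ℓ (φ c)) k s = chainProd G k (fun r => φ (s r))
  | 0, _ => rfl
  | k + 1, s => by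
      rw [chainProd, chainProd, chainProd_comp G φ k (Fin.init s)]
      rfl

/-- Transport of a chain along an equality of lengths (bookkeeping).
[cite: KazeevKhoromskij2012, Rem. 0.6] -/
theorem chainProd_cast {n : ℕ} (G : ℕ → σ → Matrix (Fin n) (Fin n) K) {k k' : ℕ} (h : k = k')
    (s : Fin k' → σ) : chainProd G k' s = chainProd G k (fun i => s (i.cast h)) := by
  subst h
  rfl

/-- SPLITTING A CHAIN (the strong Kronecker product is associative): the chain over `k + m` sites
is the chain over the first `k` sites times the chain, with shifted cores, over the last `m`.
[cite: KazeevKhoromskij2012, Rem. 0.6] -/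
theorem chainProd_add {n : ℕ} (G : ℕ → σ → Matrix (Fin n) (Fin n) K) (k : ℕ) :
    ∀ (m : ℕ) (s : Fin (k + m) → σ),
      chainProd G (k + m) s =
        chainProd G k (fun i => s (Fin.castAdd m i)) *
          chainProd (fun ℓ => G (k + ℓ)) m (fun j => s (Fin.natAdd k j))
  | 0, s => by
      rw [chainProd, Matrix.mul_one]
      rfl
  | m + 1, s => by
      show chainProd G (k + m) (Fin.init s) * G (k + m) (s (Fin.last (k + m))) =
        chainProd G k (fun i => s (Fin.castAdd (m + 1) i)) *
          (chainProd (fun ℓ => G (k + ℓ)) m (Fin.init fun j => s (Fin.natAdd k j)) *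
            G (k + m) (s (Fin.natAdd k (Fin.last m))))
      rw [chainProd_add G k m (Fin.init s), Matrix.mul_assoc]
      rfl

/-- GROUPING SITES INTO SUPERCORES (Rem. 1.2, Lem. 1.3: a QTT decomposition with `D·d` sites read
as a TT decomposition with `D` supercores of `d` sites each): with the sites enumerated
`(k, t) ↦ k·d + t` (`finProdFinEquiv`), the chain over all `D·d` sites is the chain over `k < D`
of the `d`-site chains of the blocks.  [cite: KazeevKhoromskij2012, Rem. 1.2] -/
theorem chainProd_mul_eq_chainProd_chainProd {n : ℕ} (G : ℕ → σ → Matrix (Fin n) (Fin n) K)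
    (d : ℕ) : ∀ (D : ℕ) (s : Fin (D * d) → σ),
      chainProd G (D * d) s =
        chainProd (fun k (g : Fin d → σ) => chainProd (fun t => G (k * d + t)) d g) D
          (fun k t => s (finProdFinEquiv (k, t)))
  | 0, s => by
      rw [chainProd, chainProd_cast G (Nat.zero_mul d).symm s]
      rfl
  | D + 1, s => by
      have h : D * d + d = (D + 1) * d := (Nat.succ_mul D d).symm
      rw [chainProd_cast G h s, chainProd_add, chainProd_mul_eq_chainProd_chainProd G d D,
        chainProd]
      refine congrArg₂ (· * ·) ?_ ?_
      · refine congrArg _ (funext fun k => funext fun t => congrArg s (Fin.ext ?_))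
        simp [finProdFinEquiv]
      · refine congrArg _ (funext fun t => congrArg s (Fin.ext ?_))
        simp [finProdFinEquiv]
        ring

/-- RE-BRACKETING A SANDWICHED CHAIN:
`(v P) · (M₀ P)(M₁ P)⋯(M_{D-1} P) = (v · (P M₀)(P M₁)⋯(P M_{D-1})) P`
— how a chain of `q × p` supercore matrices closed up by a `p × q` bond matrix `P` is read as a
chain of the `p × p` cores `P M_k` (used for the rank-2 junctions of Cor. 2.3/2.4).
[cite: KazeevKhoromskij2012, Lem. 1.3] -/
theorem vecMul_vecMul_chainProd_mul {τ : Type*} {p q : ℕ} (P : Matrix (Fin p) (Fin q) K)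
    (M : ℕ → τ → Matrix (Fin q) (Fin p) K) (v : Fin p → K) :
    ∀ (D : ℕ) (F : Fin D → τ),
      (v ᵥ* P) ᵥ* chainProd (fun k g => M k g * P) D F =
        (v ᵥ* chainProd (fun k g => P * M k g) D F) ᵥ* P
  | 0, _ => by simp [chainProd]
  | D + 1, F => by
      rw [chainProd, chainProd, ← Matrix.vecMul_vecMul, vecMul_vecMul_chainProd_mul P M v D]
      simp only [Matrix.vecMul_vecMul, Matrix.mul_assoc]

/-- The segment products of a train in uniform form are chains of the shifted cores
(bookkeeping companion of `leftProd_uniform`).  [cite: KazeevKhoromskij2012, Rem. 0.6] -/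
theorem segProd_uniform {n : ℕ} (L : ℕ) (G : ℕ → σ → Matrix (Fin n) (Fin n) K) (α β : Fin n → K)
    (k : ℕ) : ∀ (m : ℕ) (t : Fin m → σ),
      (uniform L n G α β).segProd k m t = chainProd (fun ℓ => G (k + ℓ)) m t
  | 0, _ => rfl
  | m + 1, t => by
      rw [segProd_succ, segProd_uniform L G α β k m (Fin.init t)]
      rfl

end TensorTrain

/-! ### Kronecker products of families and the Laplace-like operator (8) -/

section LaplaceLike

variable {K : Type u} [CommSemiring K] {ι ι' ι'' σ : Type*} {L D : ℕ}

/-- The KRONECKER (TENSOR) PRODUCT `A₀ ⊗ A₁ ⊗ ⋯ ⊗ A_{L-1}` of a family of matrices, as a matrix on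
multi-indices: `(⊗_r A_r)((i_r), (j_r)) = ∏_r A_r(i_r, j_r)`.
[cite: KazeevKhoromskij2012, Rem. 0.6] -/
def kronPi (A : Fin L → Matrix ι ι' K) : Matrix (Fin L → ι) (Fin L → ι') K :=
  Matrix.of fun i j => ∏ r, A r (i r) (j r)

/-- Definitional unfolding of `kronPi`.  [cite: KazeevKhoromskij2012, Rem. 0.6] -/
@[simp] theorem kronPi_apply (A : Fin L → Matrix ι ι' K) (i : Fin L → ι) (j : Fin L → ι') :
    kronPi A i j = ∏ r, A r (i r) (j r) := rfl

/-- The mixed-product property `(⊗_r A_r)(⊗_r B_r) = ⊗_r (A_r B_r)`.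
[cite: KazeevKhoromskij2012, Rem. 0.6] -/
theorem kronPi_mul_kronPi [Fintype ι'] (A : Fin L → Matrix ι ι' K) (B : Fin L → Matrix ι' ι'' K) :
    kronPi A * kronPi B = kronPi fun r => A r * B r := by
  ext i j
  simp only [Matrix.mul_apply, kronPi_apply, ← Finset.prod_mul_distrib]
  exact (Fintype.prod_sum fun r (x : ι') => A r (i r) x * B r x (j r)).symm

/-- `⊗_r I = I`.  [cite: KazeevKhoromskij2012, Rem. 0.6] -/
theorem kronPi_one [DecidableEq ι] : kronPi (fun _ : Fin L => (1 : Matrix ι ι K)) = 1 := by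
  ext i j
  simp only [kronPi_apply, Matrix.one_apply]
  by_cases h : i = j
  · subst h
    simp
  · obtain ⟨r, hr⟩ := Function.ne_iff.mp h
    rw [if_neg h]
    exact Finset.prod_eq_zero (Finset.mem_univ r) (if_neg hr)

/-- Two factors: `kronPi` on `Fin 2 → ι` is Mathlib's Kronecker product `A₀ ⊗ₖ A₁` up to the
relabelling `(Fin 2 → ι) ≃ ι × ι`.  [cite: KazeevKhoromskij2012, Rem. 0.6] -/
theorem reindex_kronPi_two (A : Fin 2 → Matrix ι ι' K) :
    Matrix.reindex (finTwoArrowEquiv ι) (finTwoArrowEquiv ι') (kronPi A) = A 0 ⊗ₖ A 1 := by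
  ext ⟨i₀, i₁⟩ ⟨j₀, j₁⟩
  simp [kronPi, Fin.prod_univ_two, finTwoArrowEquiv, piFinTwoEquiv]

/-- THE RANK-ONE TRAIN OF A KRONECKER PRODUCT: cores the `1 × 1` matrices `[A_k(a)]`.
[cite: KazeevKhoromskij2012, Rem. 0.6] -/
def kronTrain (A : ℕ → σ → K) (L : ℕ) : TensorTrain K σ L :=
  TensorTrain.uniform L 1 (fun k a => !![A k a]) ![1] ![1]

/-- The chain of `1 × 1` cores is the `1 × 1` matrix of the product (bookkeeping).
[cite: KazeevKhoromskij2012, Rem. 0.6] -/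
theorem chainProd_kron (A : ℕ → σ → K) :
    ∀ (L : ℕ) (s : Fin L → σ),
      TensorTrain.chainProd (fun k a => !![A k a]) L s = !![∏ r : Fin L, A r (s r)]
  | 0, _ => by
      ext i j
      fin_cases i; fin_cases j
      simp [TensorTrain.chainProd]
  | L + 1, s => by
      rw [TensorTrain.chainProd, chainProd_kron A L (Fin.init s), Fin.prod_univ_castSucc]
      ext i j
      fin_cases i; fin_cases j
      simp [Matrix.mul_apply, Fin.init]

/-- `A₀ ⊗ ⋯ ⊗ A_{L-1} = [A₀] ⋈ [A₁] ⋈ ⋯ ⋈ [A_{L-1}]` (Rem. 0.6, "a tensor product of A and B"):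
the value of the rank-one train is the product of the site values.
[cite: KazeevKhoromskij2012, Rem. 0.6] -/
theorem eval_kronTrain (A : ℕ → σ → K) (L : ℕ) (s : Fin L → σ) :
    (kronTrain A L).eval s = ∏ r : Fin L, A r (s r) := by
  rw [kronTrain, TensorTrain.eval_uniform, chainProd_kron]
  simp [Matrix.vecMul, dotProduct]

/-- Hence the TT matrix of the rank-one train with matrix-valued sites is the Kronecker product.
[cite: KazeevKhoromskij2012, Rem. 0.6] -/
theorem ttMatrix_kronTrain (A : ℕ → Matrix ι ι' K) (L : ℕ) :
    (kronTrain (fun k (p : ι × ι') => A k p.1 p.2) L).ttMatrix = kronPi fun r : Fin L => A r := by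
  ext i j
  rw [TensorTrain.ttMatrix_apply, eval_kronTrain, kronPi_apply]

/-- THE LAPLACE-LIKE OPERATOR (8):
`L^{(D)} = Σ_{q} L₀ ⊗ ⋯ ⊗ L_{q-1} ⊗ M_q ⊗ R_{q+1} ⊗ ⋯ ⊗ R_{D-1}`
(`M₁ ⊗ R₂ ⊗ ⋯ ⊗ R_D + L₁ ⊗ M₂ ⊗ R₃ ⊗ ⋯ ⊗ R_D + ⋯ + L₁ ⊗ ⋯ ⊗ L_{D-1} ⊗ M_D` in the paper's
numbering from `1`).  Honest scope: all factors of one kind share one index type here (the paper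
allows sizes `m_k × n_k` depending on `k`).  [cite: KazeevKhoromskij2012, eq. (8)] -/
def laplaceLike (Lm M R : Fin D → Matrix ι ι' K) : Matrix (Fin D → ι) (Fin D → ι') K :=
  ∑ q : Fin D, kronPi fun r => if r < q then Lm r else if r = q then M r else R r

/-- Entries of the Laplace-like operator.  [cite: KazeevKhoromskij2012, eq. (8)] -/
theorem laplaceLike_apply (Lm M R : Fin D → Matrix ι ι' K) (i : Fin D → ι) (j : Fin D → ι') :
    laplaceLike Lm M R i j =
      ∑ q : Fin D, ∏ r : Fin D,
        if r < q then Lm r (i r) (j r) else if r = q then M r (i r) (j r) else R r (i r) (j r) := by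
  simp only [laplaceLike, Matrix.sum_apply, kronPi_apply]
  refine Finset.sum_congr rfl fun q _ => Finset.prod_congr rfl fun r _ => ?_
  split_ifs <;> rfl

/-- The `2 × 2` core matrix `[L_k M_k; 0 R_k]` of Lem. 1.1 at site `k`, as a function of the
leg value (for matrix-valued `L_k, M_k, R_k` the leg is the index pair and the entries are the
matrix entries).  [cite: KazeevKhoromskij2012, Lem. 1.1] -/
def laplaceLikeCore (Lm M R : ℕ → σ → K) (k : ℕ) (a : σ) : Matrix (Fin 2) (Fin 2) K :=
  !![Lm k a, M k a; 0, R k a]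

/-- The first core `[L₁ M₁]` of Lem. 1.1 (`1 × 2`).  [cite: KazeevKhoromskij2012, Lem. 1.1] -/
def laplaceLikeFirst (Lm M : ℕ → σ → K) (a : σ) : Matrix (Fin 1) (Fin 2) K :=
  !![Lm 0 a, M 0 a]

/-- The last core `[M_D; R_D]` of Lem. 1.1 (`2 × 1`; `n` is the site index of the last site).
[cite: KazeevKhoromskij2012, Lem. 1.1] -/
def laplaceLikeLast (M R : ℕ → σ → K) (n : ℕ) (a : σ) : Matrix (Fin 2) (Fin 1) K :=
  !![M n a; R n a]

/-- THE RANK-2 TRAIN OF LEM. 1.1 in uniform form: cores `[L_k M_k; 0 R_k]`, boundary vectors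
`(1, 0)` and `(0, 1)` (so that `(1,0)·[L₁ M₁; 0 R₁] = [L₁ M₁]` and `[L M; 0 R]·(0,1)ᵀ = [M; R]`).
[cite: KazeevKhoromskij2012, Lem. 1.1] -/
def laplaceLikeTrain (Lm M R : ℕ → σ → K) (D : ℕ) : TensorTrain K σ D :=
  TensorTrain.uniform D 2 (laplaceLikeCore Lm M R) ![1, 0] ![0, 1]

/-- The `q`-th summand of (8) evaluated along a configuration:
`∏_{r<q} L_r(s_r) · M_q(s_q) · ∏_{r>q} R_r(s_r)`.  [cite: KazeevKhoromskij2012, eq. (8)] -/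
def laplaceLikeTerm (Lm M R : ℕ → σ → K) (k : ℕ) (s : Fin k → σ) (q : ℕ) : K :=
  ∏ r : Fin k, if (r : ℕ) < q then Lm r (s r) else if (r : ℕ) = q then M r (s r) else R r (s r)

/-- The state of the Lem. 1.1 recursion after `k` sites: `(L₁ ⊗ ⋯ ⊗ L_k, L^{(k)})` evaluated along
the configuration — the row `[L₁ ⊗ ⋯ ⊗ L_k  L^{(k)}]` of the proof (9).
[cite: KazeevKhoromskij2012, Lem. 1.1] -/
def laplaceLikeVec (Lm M R : ℕ → σ → K) (k : ℕ) (s : Fin k → σ) : Fin 2 → K :=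
  ![∏ r : Fin k, Lm r (s r), ∑ q : Fin k, laplaceLikeTerm Lm M R k s q]

variable (Lm M R : ℕ → σ → K)

/-- [folklore] A summand with `q < k` picks up the factor `R_k` at the new site (bookkeeping). -/
private theorem laplaceLikeTerm_succ_of_lt (k : ℕ) (s : Fin (k + 1) → σ) (q : Fin k) :
    laplaceLikeTerm Lm M R (k + 1) s q =
      laplaceLikeTerm Lm M R k (Fin.init s) q * R k (s (Fin.last k)) := by
  have hq := q.isLt
  rw [laplaceLikeTerm, Fin.prod_univ_castSucc]
  simp only [Fin.val_castSucc, Fin.val_last, if_neg (show ¬ k < (q : ℕ) by omega),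
    if_neg (show ¬ k = (q : ℕ) by omega)]
  rfl

/-- [folklore] The new summand `q = k` is `L₁ ⋯ L_k · M_{k+1}` (bookkeeping). -/
private theorem laplaceLikeTerm_succ_self (k : ℕ) (s : Fin (k + 1) → σ) :
    laplaceLikeTerm Lm M R (k + 1) s k =
      (∏ r : Fin k, Lm r (Fin.init s r)) * M k (s (Fin.last k)) := by
  rw [laplaceLikeTerm, Fin.prod_univ_castSucc]
  simp only [Fin.val_castSucc, Fin.val_last, lt_irrefl, if_false, if_true]
  congr 1
  exact Finset.prod_congr rfl fun r _ => if_pos r.isLt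

/-- THE RECURSION (9): `L^{(k+1)} = L^{(k)} ⊗ R_{k+1} + L₁ ⊗ ⋯ ⊗ L_k ⊗ M_{k+1}`, i.e.
`[L₁⊗⋯⊗L_{k+1}  L^{(k+1)}] = [L₁⊗⋯⊗L_k  L^{(k)}] ⋈ [L_{k+1} M_{k+1}; 0 R_{k+1}]`, entrywise.
[cite: KazeevKhoromskij2012, Lem. 1.1] -/
theorem laplaceLikeVec_succ (k : ℕ) (s : Fin (k + 1) → σ) :
    laplaceLikeVec Lm M R (k + 1) s =
      laplaceLikeVec Lm M R k (Fin.init s) ᵥ* laplaceLikeCore Lm M R k (s (Fin.last k)) := by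
  ext j
  fin_cases j
  · simp [laplaceLikeVec, laplaceLikeCore, Matrix.vecMul, dotProduct, Fin.sum_univ_two,
      Fin.prod_univ_castSucc, Fin.init]
  · simp only [laplaceLikeVec, laplaceLikeCore, Matrix.vecMul, dotProduct, Fin.sum_univ_two]
    simp only [Fin.isValue, Fin.mk_one, cons_val_one, cons_val_zero, Matrix.cons_val_fin_one,
      of_apply, cons_val', empty_val']
    rw [Fin.sum_univ_castSucc, Fin.val_last, laplaceLikeTerm_succ_self, Finset.sum_mul]
    simp_rw [Fin.val_castSucc, laplaceLikeTerm_succ_of_lt]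
    ring

/-- Iterating (9) from `[L₁ M₁] = (1, 0) ⋈ [L₁ M₁; 0 R₁]`: the row state after `k` sites.
[cite: KazeevKhoromskij2012, Lem. 1.1] -/
theorem vecMul_chainProd_laplaceLikeCore :
    ∀ (k : ℕ) (s : Fin k → σ),
      ![(1 : K), 0] ᵥ* TensorTrain.chainProd (laplaceLikeCore Lm M R) k s =
        laplaceLikeVec Lm M R k s
  | 0, s => by
      ext j
      fin_cases j <;> simp [TensorTrain.chainProd, laplaceLikeVec]
  | k + 1, s => by
      rw [TensorTrain.chainProd, ← Matrix.vecMul_vecMul, vecMul_chainProd_laplaceLikeCore k,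
        laplaceLikeVec_succ]

/-- The value of the Lem. 1.1 train along a configuration is the sum of the `D` summands of (8)
evaluated along it.  [cite: KazeevKhoromskij2012, Lem. 1.1] -/
theorem eval_laplaceLikeTrain (D : ℕ) (s : Fin D → σ) :
    (laplaceLikeTrain Lm M R D).eval s = ∑ q : Fin D, laplaceLikeTerm Lm M R D s q := by
  rw [laplaceLikeTrain, TensorTrain.eval_uniform, vecMul_chainProd_laplaceLikeCore]
  simp [laplaceLikeVec, dotProduct, Fin.sum_univ_two]

variable {Lm M R}

/-- LEMMA 1.1 (KAZEEV–KHOROMSKIJ): FOR EVERY `D` THE LAPLACE-LIKE OPERATOR (8) HAS THE RANK-`2 ⋯ 2`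
TT REPRESENTATION `L^{(D)} = [L₁ M₁] ⋈ [L₂ M₂; 0 R₂] ⋈ ⋯ ⋈ [L_{D-1} M_{D-1}; 0 R_{D-1}] ⋈ [M_D; R_D]`
— here in uniform form: the TT matrix of the train with cores `[L_k M_k; 0 R_k]` (entries read at
the index pair of site `k`) and boundary vectors `(1, 0)`, `(0, 1)` is `L^{(D)}`, for all `D ≥ 0`.
[cite: KazeevKhoromskij2012, Lem. 1.1] -/
theorem ttMatrix_laplaceLikeTrain (Lm M R : ℕ → Matrix ι ι' K) (D : ℕ) :
    (laplaceLikeTrain (fun k (p : ι × ι') => Lm k p.1 p.2) (fun k p => M k p.1 p.2)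
        (fun k p => R k p.1 p.2) D).ttMatrix =
      laplaceLike (fun k : Fin D => Lm k) (fun k => M k) (fun k => R k) := by
  ext i j
  rw [TensorTrain.ttMatrix_apply, eval_laplaceLikeTrain, laplaceLike_apply]
  refine Finset.sum_congr rfl fun q _ => Finset.prod_congr rfl fun r _ => ?_
  simp only [Fin.lt_def, Fin.ext_iff]

/-- [folklore] The first core of Lem. 1.1 is `(1, 0) ⋈ [L₁ M₁; 0 R₁]` (bookkeeping). -/
private theorem laplaceLikeFirst_eq (a : σ) :
    laplaceLikeFirst Lm M a =
      Matrix.of fun (_ : Fin 1) j => (![(1 : K), 0] ᵥ* laplaceLikeCore Lm M R 0 a) j := by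
  ext i j
  fin_cases i; fin_cases j <;>
    simp [laplaceLikeFirst, laplaceLikeCore, Matrix.vecMul, dotProduct, Fin.sum_univ_two]

/-- [folklore] The last core of Lem. 1.1 is `[L M; 0 R] ⋈ (0, 1)ᵀ` (bookkeeping). -/
private theorem laplaceLikeLast_eq (n : ℕ) (a : σ) :
    laplaceLikeLast M R n a =
      Matrix.of fun i (_ : Fin 1) => (laplaceLikeCore Lm M R n a *ᵥ ![(0 : K), 1]) i := by
  ext i j
  fin_cases j; fin_cases i <;>
    simp [laplaceLikeLast, laplaceLikeCore, Matrix.mulVec, dotProduct, Fin.sum_univ_two]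

/-- [folklore] The entry of `row · M · column` is the bilinear pairing (bookkeeping). -/
private theorem row_mul_mul_col_apply₂ {n : ℕ} (u v : Fin n → K) (X : Matrix (Fin n) (Fin n) K) :
    (Matrix.of (fun (_ : Fin 1) j => u j) * X * Matrix.of (fun i (_ : Fin 1) => v i)) 0 0 =
      u ᵥ* X ⬝ᵥ v := by
  simp only [Matrix.mul_apply, Matrix.vecMul, dotProduct, Matrix.of_apply]

/-- LEMMA 1.1 VERBATIM (`D = k + 2 ≥ 2`, matrix-valued sites): the `((i_k), (j_k))` entry of
`L^{(D)}` is the unique entry of the `1 × 1` matrix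
`[L₁ M₁](i₁,j₁) · [L₂ M₂; 0 R₂](i₂,j₂) ⋯ [L_{D-1} M_{D-1}; 0 R_{D-1}](i_{D-1},j_{D-1})
   · [M_D; R_D](i_D,j_D)`,
the block entry of the strong Kronecker product `[L₁ M₁] ⋈ [L₂ M₂; R₂] ⋈ ⋯ ⋈ [M_D; R_D]` (Rem. 0.6).
[cite: KazeevKhoromskij2012, Lem. 1.1] -/
theorem laplaceLike_eq_first_mul_chainProd_mul_last (Lm M R : ℕ → Matrix ι ι' K) (k : ℕ)
    (i : Fin (k + 2) → ι) (j : Fin (k + 2) → ι') :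
    laplaceLike (fun q : Fin (k + 2) => Lm q) (fun q => M q) (fun q => R q) i j =
      (laplaceLikeFirst (fun q (p : ι × ι') => Lm q p.1 p.2) (fun q p => M q p.1 p.2) (i 0, j 0) *
        TensorTrain.chainProd
          (fun ℓ => laplaceLikeCore (fun q (p : ι × ι') => Lm q p.1 p.2) (fun q p => M q p.1 p.2)
            (fun q p => R q p.1 p.2) (ℓ + 1)) k
          (fun r : Fin k => (i r.succ.castSucc, j r.succ.castSucc)) *
        laplaceLikeLast (fun q (p : ι × ι') => M q p.1 p.2) (fun q p => R q p.1 p.2) (k + 1)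
          (i (Fin.last (k + 1)), j (Fin.last (k + 1)))) 0 0 := by
  rw [← ttMatrix_laplaceLikeTrain, TensorTrain.ttMatrix_apply, laplaceLikeTrain,
    TensorTrain.eval_uniform, TensorTrain.chainProd, TensorTrain.chainProd_succ_eq_core_mul,
    laplaceLikeFirst_eq, laplaceLikeLast_eq (Lm := fun q (p : ι × ι') => Lm q p.1 p.2),
    row_mul_mul_col_apply₂]
  simp only [← Matrix.vecMul_vecMul, Matrix.dotProduct_mulVec]
  rfl

/-! ### Corollary 2.3: the `D`-dimensional Laplacian (3) at the level of dimensions -/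

variable [DecidableEq ι]

/-- THE `D`-DIMENSIONAL LAPLACE OPERATOR (3):
`Δ^{(d₁…d_D)} = a₁Δ₁ ⊗ I ⊗ ⋯ ⊗ I + ⋯ + I ⊗ ⋯ ⊗ I ⊗ a_D Δ_D`, with weights `a_k` and one-dimensional
matrices `Δ_k` — the Laplace-like operator (8) with `L_k = R_k = I`, `M_k = a_k Δ_k`.  Honest
scope: one common index type for all dimensions (the paper allows sizes `2^{d_k}`).
[cite: KazeevKhoromskij2012, eq. (3)] -/
def laplaceMulti (a : Fin D → K) (Δ : Fin D → Matrix ι ι K) : Matrix (Fin D → ι) (Fin D → ι) K :=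
  laplaceLike (fun _ => 1) (fun k => a k • Δ k) (fun _ => 1)

/-- Entries of (3): `Δ^{(D)}((i_k), (j_k)) = Σ_k a_k Δ_k(i_k, j_k) · ∏_{r ≠ k} 𝟙[i_r = j_r]`.
[cite: KazeevKhoromskij2012, eq. (3)] -/
theorem laplaceMulti_apply (a : Fin D → K) (Δ : Fin D → Matrix ι ι K) (i j : Fin D → ι) :
    laplaceMulti a Δ i j =
      ∑ k : Fin D, a k * Δ k (i k) (j k) *
        ∏ r ∈ Finset.univ.erase k, (1 : Matrix ι ι K) (i r) (j r) := by
  rw [laplaceMulti, laplaceLike_apply]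
  refine Finset.sum_congr rfl fun k _ => ?_
  rw [← Finset.mul_prod_erase _ _ (Finset.mem_univ k), if_neg (lt_irrefl k), if_pos rfl,
    Matrix.smul_apply, smul_eq_mul]
  congr 1
  refine Finset.prod_congr rfl fun r hr => ?_
  rw [Finset.mem_erase] at hr
  rw [if_neg hr.1]
  split_ifs <;> rfl

/-- Two dimensions: (3) is the Kronecker sum `a₀Δ₀ ⊕ a₁Δ₁ = a₀Δ₀ ⊗ I + I ⊗ a₁Δ₁` (Bernstein's
`kroneckerSum` in the tree) up to the relabelling `(Fin 2 → ι) ≃ ι × ι`.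
[cite: KazeevKhoromskij2012, eq. (3)] -/
theorem reindex_laplaceMulti_two [Fintype ι] (a : Fin 2 → K) (Δ : Fin 2 → Matrix ι ι K) :
    Matrix.reindex (finTwoArrowEquiv ι) (finTwoArrowEquiv ι) (laplaceMulti a Δ) =
      Literature.Analysis.Matrix.KroneckerSum.kroneckerSum (a 0 • Δ 0) (a 1 • Δ 1) := by
  ext ⟨i₀, i₁⟩ ⟨j₀, j₁⟩
  simp [laplaceMulti, laplaceLike_apply, Fin.sum_univ_two, Fin.prod_univ_two, finTwoArrowEquiv,
    piFinTwoEquiv, Literature.Analysis.Matrix.KroneckerSum.kroneckerSum, Matrix.one_apply]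

/-- The `2 × 2` core matrix `[I  a_kΔ_k; 0  I]` of Cor. 2.3 at dimension `k`, entries read at the
index pair `(i_k, j_k)`.  [cite: KazeevKhoromskij2012, Cor. 2.3] -/
def laplaceMultiCore (c : K) (Δ : Matrix ι ι K) (p : ι × ι) : Matrix (Fin 2) (Fin 2) K :=
  !![(1 : Matrix ι ι K) p.1 p.2, c * Δ p.1 p.2; 0, (1 : Matrix ι ι K) p.1 p.2]

/-- THE TRAIN OF COR. 2.3 over the `D` dimensions (uniform form, boundary vectors `(1,0)`, `(0,1)`).
[cite: KazeevKhoromskij2012, Cor. 2.3] -/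
def laplaceMultiTrain (a : ℕ → K) (Δ : ℕ → Matrix ι ι K) (D : ℕ) : TensorTrain K (ι × ι) D :=
  TensorTrain.uniform D 2 (fun k => laplaceMultiCore (a k) (Δ k)) ![1, 0] ![0, 1]

/-- The Cor. 2.3 train is the Lem. 1.1 train with `L = R = I`, `M_k = a_kΔ_k` (definitional).
[cite: KazeevKhoromskij2012, Cor. 2.3] -/
theorem laplaceMultiTrain_eq (a : ℕ → K) (Δ : ℕ → Matrix ι ι K) (D : ℕ) :
    laplaceMultiTrain a Δ D =
      laplaceLikeTrain (fun _ (p : ι × ι) => (1 : Matrix ι ι K) p.1 p.2)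
        (fun k p => a k * Δ k p.1 p.2) (fun _ p => (1 : Matrix ι ι K) p.1 p.2) D := rfl

/-- COROLLARY 2.3 (KAZEEV–KHOROMSKIJ), LEVEL OF DIMENSIONS: for every `D` the `D`-dimensional
Laplacian (3) has the rank-`2 ⋯ 2` TT structure
`Δ^{(d₁…d_D)} = [I a₁Δ₁] ⋈ [I a₂Δ₂; 0 I] ⋈ ⋯ ⋈ [I a_{D-1}Δ_{D-1}; 0 I] ⋈ [a_DΔ_D; I]`
in terms of the one-dimensional operators `a_kΔ_k` (uniform form, all `D ≥ 0`).
[cite: KazeevKhoromskij2012, Cor. 2.3] -/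
theorem ttMatrix_laplaceMultiTrain (a : ℕ → K) (Δ : ℕ → Matrix ι ι K) (D : ℕ) :
    (laplaceMultiTrain a Δ D).ttMatrix = laplaceMulti (fun k : Fin D => a k) (fun k => Δ k) := by
  have h := ttMatrix_laplaceLikeTrain (fun _ => (1 : Matrix ι ι K)) (fun k => a k • Δ k)
    (fun _ => 1) D
  simp only [Matrix.smul_apply, smul_eq_mul] at h
  exact h

end LaplaceLike

/-! ### Corollary 2.4: QTT structure of the supercores `[I^{⊗d} a_kΔ_DD; 0 I^{⊗d}]` -/

section Supercores

variable (K : Type u) [CommRing K]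

/-- The middle QTT core `[I J' J 0; 0 J 0 0; 0 0 J' 0; 0 0 0 I] = diag(W, I)` of the supercores of
Cor. 2.4 (`W` the rank-3 Laplace core of Lem. 2.1, the fourth channel carrying `I^{⊗d}`).
[cite: KazeevKhoromskij2012, Cor. 2.4] -/
def lapSupCore (p : Fin 2 × Fin 2) : Matrix (Fin 4) (Fin 4) K :=
  !![blkI K p, blkJ' K p, blkJ K p, 0; 0, blkJ K p, 0, 0; 0, 0, blkJ' K p, 0; 0, 0, 0, blkI K p]

/-- The first QTT core `[I J' J 0; 0 0 0 I]` of the middle supercore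
`[I^{⊗d} a_kΔ_DD^{(d)}; 0 I^{⊗d}]` of Cor. 2.4 (`2 × 4`).  [cite: KazeevKhoromskij2012, Cor. 2.4] -/
def supFirst (p : Fin 2 × Fin 2) : Matrix (Fin 2) (Fin 4) K :=
  !![blkI K p, blkJ' K p, blkJ K p, 0; 0, 0, 0, blkI K p]

/-- The last QTT core `[I a_k(2I - J - J'); 0 -a_kJ; 0 -a_kJ'; 0 I]` of the middle supercore of
Cor. 2.4 (`4 × 2`; `c = a_k`).  [cite: KazeevKhoromskij2012, Cor. 2.4] -/
def supLast (c : K) (p : Fin 2 × Fin 2) : Matrix (Fin 4) (Fin 2) K :=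
  !![blkI K p, c * (2 * blkI K p - blkJ K p - blkJ' K p); 0, -c * blkJ K p; 0, -c * blkJ' K p;
    0, blkI K p]

/-- The last QTT core `[I a_k(2I - J - J'); 0 -a_kJ; 0 -a_kJ']` of the FIRST supercore
`[I^{⊗d} a_kΔ_DD^{(d)}]` of Cor. 2.4 (`3 × 2`).  [cite: KazeevKhoromskij2012, Cor. 2.4] -/
def supLast₁ (c : K) (p : Fin 2 × Fin 2) : Matrix (Fin 3) (Fin 2) K :=
  !![blkI K p, c * (2 * blkI K p - blkJ K p - blkJ' K p); 0, -c * blkJ K p; 0, -c * blkJ' K p]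

/-- The LEFT BOND MATRIX `E = [1 0 0 0; 0 0 0 1]` of the rank-2 bond between supercores
(uniform-form device: `supFirst = E ⋈ diag(W, I)`).  [cite: KazeevKhoromskij2012, Cor. 2.4] -/
def supL : Matrix (Fin 2) (Fin 4) K :=
  !![1, 0, 0, 0; 0, 0, 0, 1]

/-- The RIGHT BOND MATRIX `B(c) = [1 2c; 0 -c; 0 -c; 0 1]` of the rank-2 bond between supercores
(uniform-form device: `supLast c = diag(W, I) ⋈ B(c)`).  [cite: KazeevKhoromskij2012, Cor. 2.4] -/
def supR (c : K) : Matrix (Fin 4) (Fin 2) K :=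
  !![1, 2 * c; 0, -c; 0, -c; 0, 1]

/-- The `3 × 2` variant `[1 2c; 0 -c; 0 -c]` of the right bond matrix for the first supercore
(`supLast₁ c = W ⋈ B₁(c)`).  [cite: KazeevKhoromskij2012, Cor. 2.4] -/
def supR₁ (c : K) : Matrix (Fin 3) (Fin 2) K :=
  !![1, 2 * c; 0, -c; 0, -c]

/-- States of the supercore automaton started from `(x, 0, 0, y)`:
`(x𝟙[m = n], x𝟙[m = n+1], x𝟙[n = m+1], y𝟙[m = n])` — the Laplace states of Lem. 2.1 in the
first three channels and the identity `I^{⊗k}` in the fourth.  [cite: KazeevKhoromskij2012, Cor. 2.4] -/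
def supVec (x y : K) (m n : ℕ) : Fin 4 → K :=
  ![if m = n then x else 0, if m = n + 1 then x else 0, if n = m + 1 then x else 0,
    if m = n then y else 0]

/-- THE JUNCTION CORE between consecutive supercores of the QTT Laplacian: the last core
`[I c(2I-J-J'); 0 -cJ; 0 -cJ'; 0 I]` of a supercore merged over the rank-2 bond with `E`
(`supLast c ⋈ E`, a `4 × 4` core of rank `≤ 2`).  [cite: KazeevKhoromskij2012, Cor. 2.4] -/
def lapJunction (c : K) (p : Fin 2 × Fin 2) : Matrix (Fin 4) (Fin 4) K :=
  supLast K c p * supL K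

/-- THE QTT TRAIN OF THE `D`-DIMENSIONAL DIRICHLET LAPLACIAN `Δ_DD^{(d…d)}` (Cor. 2.3 assembled
from the supercores of Cor. 2.4 by Rem. 1.2 / Lem. 1.3), in uniform form with bond dimension `4`
on `D·d` sites `ℓ = k·d + t` (dimension `k`, bit `t`, most significant first): core `diag(W, I)`
at the inner sites of each dimension, the junction core `supLast a_k ⋈ E` at the last site of
dimension `k`, boundary vectors `(1,0,0,0) = (1,0)·E` and `(0,0,0,1)` (`E·(0,0,0,1)ᵀ = (0,1)ᵀ`).
[cite: KazeevKhoromskij2012, Cor. 2.4] -/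
def lapMultiTrain (a : ℕ → K) (D d : ℕ) : TensorTrain K (Fin 2 × Fin 2) (D * d) :=
  TensorTrain.uniform (D * d) 4
    (fun ℓ p => if ℓ % d = d - 1 then lapJunction K (a (ℓ / d)) p else lapSupCore K p)
    ![1, 0, 0, 0] ![0, 0, 0, 1]

variable {K}

/-- `supFirst = E ⋈ diag(W, I)` (bookkeeping).  [cite: KazeevKhoromskij2012, Cor. 2.4] -/
theorem supFirst_eq (p : Fin 2 × Fin 2) : supFirst K p = supL K * lapSupCore K p := by
  ext i j
  fin_cases i <;> fin_cases j <;>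
    simp [supFirst, supL, lapSupCore, Matrix.mul_apply, Fin.sum_univ_four]

/-- `supLast c = diag(W, I) ⋈ B(c)` (bookkeeping).  [cite: KazeevKhoromskij2012, Cor. 2.4] -/
theorem supLast_eq (c : K) (p : Fin 2 × Fin 2) : supLast K c p = lapSupCore K p * supR K c := by
  ext i j
  fin_cases i <;> fin_cases j <;>
    simp [supLast, supR, lapSupCore, Matrix.mul_apply, Fin.sum_univ_four] <;> ring

/-- `supLast₁ c = W ⋈ B₁(c)` (bookkeeping).  [cite: KazeevKhoromskij2012, Cor. 2.4] -/
theorem supLast₁_eq (c : K) (p : Fin 2 × Fin 2) : supLast₁ K c p = lapCore K p * supR₁ K c := by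
  ext i j
  fin_cases i <;> fin_cases j <;>
    simp [supLast₁, supR₁, lapCore, Matrix.mul_apply, Fin.sum_univ_three] <;> ring

/-- The junction core written out: `[I 0 0 c(2I-J-J'); 0 0 0 -cJ; 0 0 0 -cJ'; 0 0 0 I]`.
[cite: KazeevKhoromskij2012, Cor. 2.4] -/
theorem lapJunction_eq (c : K) (p : Fin 2 × Fin 2) :
    lapJunction K c p =
      !![blkI K p, 0, 0, c * (2 * blkI K p - blkJ K p - blkJ' K p); 0, 0, 0, -c * blkJ K p;
        0, 0, 0, -c * blkJ' K p; 0, 0, 0, blkI K p] := by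
  ext i j
  fin_cases i <;> fin_cases j <;>
    simp [lapJunction, supLast, supL, Matrix.mul_apply, Fin.sum_univ_two]

/-- [folklore] One step of the supercore automaton (bookkeeping case analysis). -/
private theorem supVec_step (x y : K) (m n : ℕ) (a a' : Fin 2) :
    supVec K x y (2 * m + a) (2 * n + a') = supVec K x y m n ᵥ* lapSupCore K (a, a') := by
  ext j
  fin_cases a <;> fin_cases a' <;> fin_cases j <;>
    simp [supVec, lapSupCore, blkI, blkJ, blkJ', Matrix.vecMul, dotProduct, Fin.sum_univ_four] <;>
    (try split_ifs) <;> first | rfl | omega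

/-- THE SUPERCORE AUTOMATON: `(x, 0, 0, y) · diag(W, I)(σ₀,μ₀) ⋯ diag(W, I)(σ_{d-1},μ_{d-1})`
is the state `supVec x y m(σ) m(μ)`.  [cite: KazeevKhoromskij2012, Cor. 2.4] -/
theorem vecMul_chainProd_lapSupCore (x y : K) (d : ℕ) (σ μ : Fin d → Fin 2) :
    ![x, 0, 0, y] ᵥ* TensorTrain.chainProd (fun _ => lapSupCore K) d (fun r => (σ r, μ r)) =
      supVec K x y (quanticsEquiv 2 d σ) (quanticsEquiv 2 d μ) := by
  have h0 : supVec K x y 0 0 = ![x, 0, 0, y] := by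
    ext j; fin_cases j <;> simp [supVec]
  rw [← h0]
  exact TensorTrain.vecMul_chainProd_of_digitStep (lapSupCore K) (fun _ => supVec K x y)
    (fun _ m m' a a' _ _ => supVec_step x y m m' a a') d σ μ

/-- [folklore] Closing a supercore with the right bond matrix (bookkeeping case analysis). -/
private theorem supVec_vecMul_supR (x y c : K) {N : ℕ} (m n : Fin N) :
    supVec K x y m n ᵥ* supR K c =
      ![x * (1 : Matrix (Fin N) (Fin N) K) m n,
        x * (c * laplaceDD K N m n) + y * (1 : Matrix (Fin N) (Fin N) K) m n] := by
  ext j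
  fin_cases j
  · simp [supVec, supR, Matrix.vecMul, dotProduct, Fin.sum_univ_four, Matrix.one_apply, Fin.ext_iff]
  · simp [supVec, supR, Matrix.vecMul, dotProduct, Fin.sum_univ_four, laplaceDD, Matrix.one_apply,
      Fin.ext_iff]
    split_ifs <;> first | omega | ring1

/-- [folklore] Closing the first supercore (bookkeeping case analysis). -/
private theorem lapVec_vecMul_supR₁ (c : K) {N : ℕ} (m n : Fin N) :
    lapVec K m n ᵥ* supR₁ K c =
      ![(1 : Matrix (Fin N) (Fin N) K) m n, c * laplaceDD K N m n] := by
  ext j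
  fin_cases j
  · simp [lapVec, supR₁, Matrix.vecMul, dotProduct, Fin.sum_univ_three, Matrix.one_apply,
      Fin.ext_iff]
  · simp [lapVec, supR₁, Matrix.vecMul, dotProduct, Fin.sum_univ_three, laplaceDD, Matrix.one_apply,
      Fin.ext_iff]
    split_ifs <;> first | omega | ring1

/-- [folklore] Rows of the bond matrix `E` (bookkeeping). -/
private theorem supL_zero : supL K 0 = ![1, 0, 0, 0] := by
  ext j; fin_cases j <;> rfl

/-- [folklore] Rows of the bond matrix `E` (bookkeeping). -/
private theorem supL_one : supL K 1 = ![0, 0, 0, 1] := by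
  ext j; fin_cases j <;> rfl

/-- [folklore] Entries of a triple product as an iterated vector–matrix product (bookkeeping). -/
private theorem mul_mul_apply_eq_vecMul {p q r : ℕ} (A : Matrix (Fin p) (Fin q) K)
    (X : Matrix (Fin q) (Fin q) K) (B : Matrix (Fin q) (Fin r) K) (i : Fin p) (j : Fin r) :
    (A * X * B) i j = ((A i ᵥ* X) ᵥ* B) j := rfl

/-- THE MIDDLE SUPERCORE IDENTITY behind Cor. 2.4, uniform form: for every `d ≥ 0`,
`E · diag(W, I)(i₁,j₁) ⋯ diag(W, I)(i_d,j_d) · B(c) = [𝟙[m = n]  cΔ_DD^{(d)}(m, n); 0  𝟙[m = n]]`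
— the `((i), (j))` block entry of the supercore `[I^{⊗d} cΔ_DD^{(d)}; 0 I^{⊗d}]`, i.e. the core of
Cor. 2.3 at this dimension read at the index pair `(m, n)`.  [cite: KazeevKhoromskij2012, Cor. 2.4] -/
theorem supL_mul_chainProd_mul_supR (c : K) (d : ℕ) (σ μ : Fin d → Fin 2) :
    supL K * TensorTrain.chainProd (fun _ => lapSupCore K) d (fun r => (σ r, μ r)) * supR K c =
      laplaceMultiCore c (laplaceDD K (2 ^ d)) (quanticsEquiv 2 d σ, quanticsEquiv 2 d μ) := by
  ext i j
  fin_cases i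
  · change ((supL K 0 ᵥ* TensorTrain.chainProd (fun _ => lapSupCore K) d (fun r => (σ r, μ r))) ᵥ*
        supR K c) j =
      laplaceMultiCore c (laplaceDD K (2 ^ d)) (quanticsEquiv 2 d σ, quanticsEquiv 2 d μ) 0 j
    rw [supL_zero, vecMul_chainProd_lapSupCore, supVec_vecMul_supR]
    fin_cases j <;> simp [laplaceMultiCore]
  · change ((supL K 1 ᵥ* TensorTrain.chainProd (fun _ => lapSupCore K) d (fun r => (σ r, μ r))) ᵥ*
        supR K c) j =
      laplaceMultiCore c (laplaceDD K (2 ^ d)) (quanticsEquiv 2 d σ, quanticsEquiv 2 d μ) 1 j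
    rw [supL_one, vecMul_chainProd_lapSupCore, supVec_vecMul_supR]
    fin_cases j <;> simp [laplaceMultiCore]

/-- The same identity for an arbitrary string of digit pairs and bracketed as `E · (chain · B(c))`
(the form used at the junctions).  [cite: KazeevKhoromskij2012, Cor. 2.4] -/
theorem supL_mul_chainProd_mul_supR' (c : K) (d : ℕ) (g : Fin d → Fin 2 × Fin 2) :
    supL K * (TensorTrain.chainProd (fun _ => lapSupCore K) d g * supR K c) =
      laplaceMultiCore c (laplaceDD K (2 ^ d))
        (quanticsEquiv 2 d (fun t => (g t).1), quanticsEquiv 2 d (fun t => (g t).2)) := by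
  rw [← Matrix.mul_assoc]
  exact supL_mul_chainProd_mul_supR c d (fun t => (g t).1) (fun t => (g t).2)

/-- COROLLARY 2.4 (KAZEEV–KHOROMSKIJ), MIDDLE SUPERCORE, VERBATIM (`d = k + 2 ≥ 2`): the
`((i₁…i_d), (j₁…j_d))` block entry of
`[I J' J 0; 0 0 0 I] ⋈ [I J' J 0; 0 J 0 0; 0 0 J' 0; 0 0 0 I]^{⋈(d-2)}
   ⋈ [I a(2I-J-J'); 0 -aJ; 0 -aJ'; 0 I]`
is `[𝟙[m=n] aΔ_DD^{(d)}(m,n); 0 𝟙[m=n]]`, the block entry of `[I^{⊗d} aΔ_DD^{(d)}; 0 I^{⊗d}]` —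
a rank-`4 ⋯ 4` QTT representation of the middle supercore.  [cite: KazeevKhoromskij2012, Cor. 2.4] -/
theorem supFirst_mul_chainProd_mul_supLast (c : K) (k : ℕ) (σ μ : Fin (k + 2) → Fin 2) :
    supFirst K (σ 0, μ 0) *
        TensorTrain.chainProd (fun _ => lapSupCore K) k
          (fun r : Fin k => (σ r.succ.castSucc, μ r.succ.castSucc)) *
        supLast K c (σ (Fin.last (k + 1)), μ (Fin.last (k + 1))) =
      laplaceMultiCore c (laplaceDD K (2 ^ (k + 2)))
        (quanticsEquiv 2 (k + 2) σ, quanticsEquiv 2 (k + 2) μ) := by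
  rw [← supL_mul_chainProd_mul_supR, TensorTrain.chainProd, TensorTrain.chainProd_succ_eq_mul,
    supFirst_eq, supLast_eq]
  simp only [Matrix.mul_assoc]
  rfl

/-- [folklore] The first core of Lem. 2.1 is `e₀ᵀ ⋈ W` (bookkeeping). -/
private theorem lapFirst_eq_of (p : Fin 2 × Fin 2) :
    lapFirst K p = Matrix.of fun (_ : Fin 1) j => (![(1 : K), 0, 0] ᵥ* lapCore K p) j := by
  ext i j
  fin_cases i; fin_cases j <;>
    simp [lapFirst, lapCore, Matrix.vecMul, dotProduct, Fin.sum_univ_three]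

/-- [folklore] A row matrix times a matrix is the row matrix of the vector–matrix product. -/
private theorem of_row_mul {q r : Type*} [Fintype q] (u : q → K) (X : Matrix q r K) :
    Matrix.of (fun (_ : Fin 1) j => u j) * X = Matrix.of fun (_ : Fin 1) j => (u ᵥ* X) j := by
  ext i j
  rfl

/-- COROLLARY 2.4, FIRST SUPERCORE, VERBATIM (`d = k + 2 ≥ 2`): the block entry of
`[I J' J] ⋈ [I J' J; 0 J 0; 0 0 J']^{⋈(d-2)} ⋈ [I a(2I-J-J'); 0 -aJ; 0 -aJ']` is
`[𝟙[m=n] aΔ_DD^{(d)}(m,n)]`, the block entry of the first supercore `[I^{⊗d} aΔ_DD^{(d)}]` —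
a rank-`3 ⋯ 3` QTT representation.  [cite: KazeevKhoromskij2012, Cor. 2.4] -/
theorem lapFirst_mul_chainProd_mul_supLast₁ (c : K) (k : ℕ) (σ μ : Fin (k + 2) → Fin 2) :
    lapFirst K (σ 0, μ 0) *
        TensorTrain.chainProd (fun _ => lapCore K) k
          (fun r : Fin k => (σ r.succ.castSucc, μ r.succ.castSucc)) *
        supLast₁ K c (σ (Fin.last (k + 1)), μ (Fin.last (k + 1))) =
      !![(1 : Matrix (Fin (2 ^ (k + 2))) (Fin (2 ^ (k + 2))) K)
          (quanticsEquiv 2 (k + 2) σ) (quanticsEquiv 2 (k + 2) μ),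
        c * laplaceDD K (2 ^ (k + 2)) (quanticsEquiv 2 (k + 2) σ) (quanticsEquiv 2 (k + 2) μ)] := by
  have key : ((![(1 : K), 0, 0] ᵥ* lapCore K (σ 0, μ 0)) ᵥ*
        TensorTrain.chainProd (fun _ => lapCore K) k
          (fun r : Fin k => (σ r.succ.castSucc, μ r.succ.castSucc))) ᵥ*
        (lapCore K (σ (Fin.last (k + 1)), μ (Fin.last (k + 1))) * supR₁ K c) =
      lapVec K (quanticsEquiv 2 (k + 2) σ) (quanticsEquiv 2 (k + 2) μ) ᵥ* supR₁ K c := by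
    rw [← vecMul_chainProd_lapCore (k + 2) σ μ, TensorTrain.chainProd,
      TensorTrain.chainProd_succ_eq_mul]
    simp only [Matrix.vecMul_vecMul, Matrix.mul_assoc]
    rfl
  ext i j
  fin_cases i
  rw [lapFirst_eq_of, supLast₁_eq, of_row_mul, of_row_mul, Matrix.of_apply, key,
    lapVec_vecMul_supR₁]
  fin_cases j <;> simp

end Supercores

/-! ### Corollary 2.4, third display: the last supercore `[aΔ_DD; I^{⊗d}]` (needs `½`) -/

section LastSupercore

variable (K : Type u) [Field K]

/-- The penultimate QTT core `[aI aJ' aJ; 0 aJ 0; 0 0 aJ'; ½I -½I -½I]` of the last supercore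
`[a_DΔ_DD^{(d)}; I^{⊗d}]` of Cor. 2.4 (`4 × 3`).  [cite: KazeevKhoromskij2012, Cor. 2.4] -/
def supPenult (c : K) (p : Fin 2 × Fin 2) : Matrix (Fin 4) (Fin 3) K :=
  !![c * blkI K p, c * blkJ' K p, c * blkJ K p; 0, c * blkJ K p, 0; 0, 0, c * blkJ' K p;
    2⁻¹ * blkI K p, -2⁻¹ * blkI K p, -2⁻¹ * blkI K p]

/-- The bond matrix `Z(c) = [c 0 0; 0 c 0; 0 0 c; ½ -½ -½]` with `supPenult c = diag(W, I) ⋈ Z(c)`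
(uniform-form device).  [cite: KazeevKhoromskij2012, Cor. 2.4] -/
def supZ (c : K) : Matrix (Fin 4) (Fin 3) K :=
  !![c, 0, 0; 0, c, 0; 0, 0, c; 2⁻¹, -2⁻¹, -2⁻¹]

variable {K}

/-- `supPenult c = diag(W, I) ⋈ Z(c)` (bookkeeping).  [cite: KazeevKhoromskij2012, Cor. 2.4] -/
theorem supPenult_eq (c : K) (p : Fin 2 × Fin 2) : supPenult K c p = lapSupCore K p * supZ K c := by
  ext i j
  fin_cases i <;> fin_cases j <;>
    simp [supPenult, supZ, lapSupCore, Matrix.mul_apply, Fin.sum_univ_four] <;> ring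

/-- [folklore] The last core of Lem. 2.1 is `W ⋈ (2, -1, -1)ᵀ` (bookkeeping). -/
private theorem lapLast_eq_of (p : Fin 2 × Fin 2) :
    lapLast K p = Matrix.of fun i (_ : Fin 1) => (lapCore K p *ᵥ ![(2 : K), -1, -1]) i := by
  ext i j
  fin_cases j; fin_cases i <;>
    simp [lapLast, lapCore, Matrix.mulVec, dotProduct, Fin.sum_univ_three]
  ring

/-- [folklore] A matrix times a column matrix is the column matrix of the matrix–vector product. -/
private theorem mul_of_col {p q : Type*} [Fintype q] (X : Matrix p q K) (v : q → K) :
    X * Matrix.of (fun i (_ : Fin 1) => v i) = Matrix.of fun i (_ : Fin 1) => (X *ᵥ v) i := by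
  ext i j
  rfl

/-- THE SWEEP OF COR. 2.4's THIRD DISPLAY (where `½` enters): for every digit pair,
`Z(c) · (W ⋈ (2,-1,-1)ᵀ) = diag(W, I) · (B(c) ⋈ (0,1)ᵀ)`, i.e.
`Z(c)·[2I-J-J'; -J; -J'] = diag(W, I)·(2c, -c, -c, 1)ᵀ`; the fourth row is `½(2I-J-J') + ½J + ½J' = I`.
Requires `2 ≠ 0` in `K`.  [cite: KazeevKhoromskij2012, Cor. 2.4] -/
theorem supZ_mulVec_lapCore_mulVec [NeZero (2 : K)] (c : K) (p : Fin 2 × Fin 2) :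
    supZ K c *ᵥ (lapCore K p *ᵥ ![2, -1, -1]) = lapSupCore K p *ᵥ (supR K c *ᵥ ![0, 1]) := by
  obtain ⟨a, a'⟩ := p
  ext j
  fin_cases a <;> fin_cases a' <;> fin_cases j <;>
    simp [supZ, lapCore, lapSupCore, supR, blkI, blkJ, blkJ', Matrix.mulVec, dotProduct,
      Fin.sum_univ_two, Fin.sum_univ_three, Fin.sum_univ_four] <;>
    first | ring1 | exact inv_mul_cancel₀ two_ne_zero

/-- COROLLARY 2.4, LAST SUPERCORE, VERBATIM (`d = k + 3 ≥ 3`, `2 ≠ 0` in `K`): the block entry of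
`[I J' J 0; 0 0 0 I] ⋈ [I J' J 0; 0 J 0 0; 0 0 J' 0; 0 0 0 I]^{⋈(d-3)}
   ⋈ [aI aJ' aJ; 0 aJ 0; 0 0 aJ'; ½I -½I -½I] ⋈ [2I-J-J'; -J; -J']`
is `[aΔ_DD^{(d)}(m,n); 𝟙[m=n]]`, the block entry of the last supercore `[a_DΔ_DD^{(d)}; I^{⊗d}]` —
a rank-`4 ⋯ 4, 3` QTT representation.  [cite: KazeevKhoromskij2012, Cor. 2.4] -/
theorem supFirst_mul_chainProd_mul_supPenult_mul_lapLast [NeZero (2 : K)] (c : K) (k : ℕ)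
    (σ μ : Fin (k + 3) → Fin 2) :
    supFirst K (σ 0, μ 0) *
          TensorTrain.chainProd (fun _ => lapSupCore K) k
            (fun r : Fin k => (σ r.succ.castSucc.castSucc, μ r.succ.castSucc.castSucc)) *
        supPenult K c (σ (Fin.last (k + 1)).castSucc, μ (Fin.last (k + 1)).castSucc) *
        lapLast K (σ (Fin.last (k + 2)), μ (Fin.last (k + 2))) =
      !![c * laplaceDD K (2 ^ (k + 3)) (quanticsEquiv 2 (k + 3) σ) (quanticsEquiv 2 (k + 3) μ);
        (1 : Matrix (Fin (2 ^ (k + 3))) (Fin (2 ^ (k + 3))) K)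
          (quanticsEquiv 2 (k + 3) σ) (quanticsEquiv 2 (k + 3) μ)] := by
  -- the chain over all `k + 3` sites
  have hchain : lapSupCore K (σ 0, μ 0) *
        TensorTrain.chainProd (fun _ => lapSupCore K) k
          (fun r : Fin k => (σ r.succ.castSucc.castSucc, μ r.succ.castSucc.castSucc)) *
        lapSupCore K (σ (Fin.last (k + 1)).castSucc, μ (Fin.last (k + 1)).castSucc) *
        lapSupCore K (σ (Fin.last (k + 2)), μ (Fin.last (k + 2))) =
      TensorTrain.chainProd (fun _ => lapSupCore K) (k + 3) (fun r => (σ r, μ r)) := by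
    rw [TensorTrain.chainProd, TensorTrain.chainProd, TensorTrain.chainProd_succ_eq_mul]
    rfl
  -- the right-hand side is the second column of the Cor. 2.3 core
  have hrhs :
      (!![c * laplaceDD K (2 ^ (k + 3)) (quanticsEquiv 2 (k + 3) σ) (quanticsEquiv 2 (k + 3) μ);
        (1 : Matrix (Fin (2 ^ (k + 3))) (Fin (2 ^ (k + 3))) K)
          (quanticsEquiv 2 (k + 3) σ) (quanticsEquiv 2 (k + 3) μ)] : Matrix (Fin 2) (Fin 1) K) =
      laplaceMultiCore c (laplaceDD K (2 ^ (k + 3)))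
          (quanticsEquiv 2 (k + 3) σ, quanticsEquiv 2 (k + 3) μ) *
        Matrix.of fun i (_ : Fin 1) => (![(0 : K), 1]) i := by
    ext i j
    fin_cases i <;> fin_cases j <;>
      simp [laplaceMultiCore, Matrix.mul_apply, Fin.sum_univ_two]
  rw [hrhs, ← supL_mul_chainProd_mul_supR, ← hchain, supFirst_eq, supPenult_eq, lapLast_eq_of]
  simp only [Matrix.mul_assoc, mul_of_col, supZ_mulVec_lapCore_mulVec]

end LastSupercore

/-! ### The assembled QTT Laplacian in `D` dimensions (Cor. 2.3 + Cor. 2.4 + Rem. 1.2) -/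

section Assembly

variable {K : Type u} [CommRing K]

/-- [folklore] Site arithmetic: the bit index of site `k·d + t` is `t` (bookkeeping). -/
private theorem site_mod (k d t : ℕ) (ht : t < d) : (k * d + t) % d = t := by
  rw [Nat.mul_comm, Nat.mul_add_mod, Nat.mod_eq_of_lt ht]

/-- [folklore] Site arithmetic: the dimension index of site `k·d + t` is `k` (bookkeeping). -/
private theorem site_div (k d t : ℕ) (ht : t < d) : (k * d + t) / d = k := by
  rw [Nat.mul_comm, Nat.mul_add_div (by omega), Nat.div_eq_of_lt ht, Nat.add_zero]

/-- THE SUPERCORE OF DIMENSION `k` INSIDE THE ASSEMBLED TRAIN: the chain over the `d + 1` sites of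
dimension `k` is `diag(W, I)(i₁,j₁) ⋯ diag(W, I)(i_d,j_d) · B(a_k) · E` — the middle supercore of
Cor. 2.4 with its terminal cores factored through the rank-2 bond.
[cite: KazeevKhoromskij2012, Cor. 2.4] -/
theorem chainProd_lapMultiTrain_block (a : ℕ → K) (k d : ℕ) (g : Fin (d + 1) → Fin 2 × Fin 2) :
    TensorTrain.chainProd
        (fun t => (fun ℓ p => if ℓ % (d + 1) = d + 1 - 1 then lapJunction K (a (ℓ / (d + 1))) p
          else lapSupCore K p) (k * (d + 1) + t)) (d + 1) g =
      TensorTrain.chainProd (fun _ => lapSupCore K) (d + 1) g * supR K (a k) * supL K := by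
  have hcongr : TensorTrain.chainProd
        (fun t => (fun ℓ p => if ℓ % (d + 1) = d + 1 - 1 then lapJunction K (a (ℓ / (d + 1))) p
          else lapSupCore K p) (k * (d + 1) + t)) d (Fin.init g) =
      TensorTrain.chainProd (fun _ => lapSupCore K) d (Fin.init g) :=
    TensorTrain.chainProd_congr (fun t ht p => by
      show (if (k * (d + 1) + t) % (d + 1) = d + 1 - 1 then _ else _) = _
      rw [site_mod k (d + 1) t (by omega), if_neg (by omega)]) (Fin.init g)
  have hlast : (fun ℓ p => if ℓ % (d + 1) = d + 1 - 1 then lapJunction K (a (ℓ / (d + 1))) p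
        else lapSupCore K p) (k * (d + 1) + d) (g (Fin.last d)) =
      lapJunction K (a k) (g (Fin.last d)) := by
    show (if (k * (d + 1) + d) % (d + 1) = d + 1 - 1 then _ else _) = _
    rw [site_mod k (d + 1) d (by omega), site_div k (d + 1) d (by omega), if_pos (by omega)]
  rw [TensorTrain.chainProd, hcongr, hlast, TensorTrain.chainProd, lapJunction, supLast_eq]
  simp only [Matrix.mul_assoc]

/-- [folklore] The boundary vectors factor through the bond matrix `E` (bookkeeping). -/
private theorem vecMul_supL : ![(1 : K), 0] ᵥ* supL K = ![1, 0, 0, 0] := by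
  ext j
  fin_cases j <;> simp [supL, Matrix.vecMul, dotProduct, Fin.sum_univ_two]

/-- [folklore] The boundary vectors factor through the bond matrix `E` (bookkeeping). -/
private theorem supL_mulVec : supL K *ᵥ ![(0 : K), 0, 0, 1] = ![0, 1] := by
  ext j
  fin_cases j <;> simp [supL, Matrix.mulVec, dotProduct, Fin.sum_univ_four]

/-- COROLLARY 2.3 WITH COROLLARY 2.4 (KAZEEV–KHOROMSKIJ): THE QTT LAPLACIAN IN `D` DIMENSIONS.
For `d ≥ 1` the value of the assembled rank-`4` train `lapMultiTrain a D d` at the bit-pair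
string `(τ_ℓ, τ'_ℓ)_{ℓ < D·d}` is the entry of the `D`-dimensional Dirichlet Laplacian
`Δ^{(d…d)} = Σ_k I ⊗ ⋯ ⊗ a_kΔ_DD^{(d)} ⊗ ⋯ ⊗ I` (eq. (3), all `d_k = d`) at the multi-indices whose
`k`-th components are the numbers with binary digits `τ_{k·d}, …, τ_{k·d+d-1}` (most significant
first) — the serial (dimension-major) QTT ordering `serialEquiv`.
[cite: KazeevKhoromskij2012, Cor. 2.4] -/
theorem eval_lapMultiTrain (a : ℕ → K) (D d : ℕ) (hd : 0 < d) (τ τ' : Fin (D * d) → Fin 2) :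
    (lapMultiTrain K a D d).eval (fun ℓ => (τ ℓ, τ' ℓ)) =
      laplaceMulti (fun k : Fin D => a k) (fun _ => laplaceDD K (2 ^ d))
        (serialEquiv 2 D d τ) (serialEquiv 2 D d τ') := by
  obtain ⟨d, rfl⟩ := Nat.exists_eq_add_one_of_ne_zero hd.ne'
  rw [lapMultiTrain, TensorTrain.eval_uniform, TensorTrain.chainProd_mul_eq_chainProd_chainProd,
    TensorTrain.chainProd_congr (fun k _ g => chainProd_lapMultiTrain_block a k d g), ← vecMul_supL,
    TensorTrain.vecMul_vecMul_chainProd_mul (supL K)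
      (fun k g => TensorTrain.chainProd (fun _ => lapSupCore K) (d + 1) g * supR K (a k)) ![1, 0] D,
    ← Matrix.dotProduct_mulVec, supL_mulVec,
    TensorTrain.chainProd_congr (fun k _ g => supL_mul_chainProd_mul_supR' (a k) (d + 1) g),
    TensorTrain.chainProd_comp
      (fun k p => laplaceMultiCore (a k) (laplaceDD K (2 ^ (d + 1))) p)
      (fun g : Fin (d + 1) → Fin 2 × Fin 2 =>
        (quanticsEquiv 2 (d + 1) (fun t => (g t).1), quanticsEquiv 2 (d + 1) (fun t => (g t).2))) D,
    ← TensorTrain.eval_uniform, show TensorTrain.uniform D 2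
        (fun k p => laplaceMultiCore (a k) (laplaceDD K (2 ^ (d + 1))) p) ![1, 0] ![0, 1] =
      laplaceMultiTrain a (fun _ => laplaceDD K (2 ^ (d + 1))) D from rfl,
    ← congrFun (congrFun (ttMatrix_laplaceMultiTrain a (fun _ => laplaceDD K (2 ^ (d + 1))) D) _) _,
    TensorTrain.ttMatrix_apply]
  rfl

/-- The same statement at the level of matrices: the TT matrix of `lapMultiTrain a D d` is the
`D`-dimensional Dirichlet Laplacian (3) with its multi-indices serialised dimension by dimension.
[cite: KazeevKhoromskij2012, Cor. 2.4] -/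
theorem ttMatrix_lapMultiTrain (a : ℕ → K) (D d : ℕ) (hd : 0 < d) :
    (lapMultiTrain K a D d).ttMatrix =
      (laplaceMulti (fun k : Fin D => a k) (fun _ => laplaceDD K (2 ^ d))).submatrix
        (serialEquiv 2 D d) (serialEquiv 2 D d) := by
  ext τ τ'
  exact eval_lapMultiTrain a D d hd τ τ'

end Assembly

/-! ### Theorem 4.1, line `Δ_DD^{(d₁…d_D)}`: the QTT ranks `…, 4 ⋯ 4, 2, 4 ⋯ 4, …` -/

section Ranks

variable {K : Type u} [Field K] {σ : Type*} [Fintype σ]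

/-- A LEFT FACTORISATION BOUNDS AN UNFOLDING RANK ("elimination of dependent QTT blocks", the
rank-reduction step of the cited proofs, row version): if the boundary row swept through the
first `k` cores of a uniform train always lies in the row space of a fixed `r × n` matrix `Y`,
`α · G₀(s₀) ⋯ G_{k-1}(s_{k-1}) = w(s) · Y`, the unfolding matrix across the bond after site
`k - 1` has rank `≤ r`.  [cite: KazeevKhoromskij2012, Thm. 4.1] -/
theorem TensorTrain.rank_unfolding_uniform_le_of_vecMul_chainProd {n r L : ℕ}
    (G : ℕ → σ → Matrix (Fin n) (Fin n) K) (α β : Fin n → K) (k m : ℕ) (h : k + m = L)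
    (Y : Matrix (Fin r) (Fin n) K) (w : (Fin k → σ) → Fin r → K)
    (hw : ∀ s, α ᵥ* TensorTrain.chainProd G k s = w s ᵥ* Y) :
    (Matrix.of fun (s : Fin k → σ) (t : Fin m → σ) =>
        (TensorTrain.uniform L n G α β).eval (fun i => Fin.append s t (i.cast h.symm))).rank ≤
      r := by
  classical
  let P : Matrix (Fin k → σ) (Fin r) K := Matrix.of w
  let Q : Matrix (Fin n) (Fin m → σ) K := Matrix.of fun l t =>
    ((Matrix.of fun l j => (TensorTrain.uniform L n G α β).segProd k m t l
        (j.cast (congrArg (TensorTrain.uniform L n G α β).r h).symm)) *ᵥ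
      (TensorTrain.uniform L n G α β).rbdry) l
  have hPQ : (Matrix.of fun (s : Fin k → σ) (t : Fin m → σ) =>
      (TensorTrain.uniform L n G α β).eval (fun i => Fin.append s t (i.cast h.symm))) =
        P * Y * Q := by
    have hl : ∀ s : Fin k → σ,
        (TensorTrain.uniform L n G α β).lbdry ᵥ* (TensorTrain.uniform L n G α β).leftProd k s =
          w s ᵥ* Y := by
      intro s
      rw [TensorTrain.leftProd_uniform]
      exact hw s
    ext s t
    rw [Matrix.of_apply, TensorTrain.eval_append_eq_sum_bond _ k m h s t, Matrix.mul_apply, hl s]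
    rfl
  rw [hPQ]
  calc (P * Y * Q).rank ≤ (P * Y).rank := Matrix.rank_mul_le_left _ _
    _ ≤ Y.rank := Matrix.rank_mul_le_right _ _
    _ ≤ Fintype.card (Fin r) := Matrix.rank_le_card_height Y
    _ = r := Fintype.card_fin r

/-- A FACTORED CORE BOUNDS THE NEXT UNFOLDING RANK: if the core at site `k` of a uniform train
factors as `G_k(a) = X(a) · Y` through `r` intermediate indices, the unfolding matrix across the
bond after site `k` has rank `≤ r`.  [cite: KazeevKhoromskij2012, Thm. 4.1] -/
theorem TensorTrain.rank_unfolding_uniform_le_of_core_eq_mul {n r L : ℕ}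
    (G : ℕ → σ → Matrix (Fin n) (Fin n) K) (α β : Fin n → K) (k m : ℕ) (h : k + 1 + m = L)
    (X : σ → Matrix (Fin n) (Fin r) K) (Y : Matrix (Fin r) (Fin n) K) (hG : ∀ a, G k a = X a * Y) :
    (Matrix.of fun (s : Fin (k + 1) → σ) (t : Fin m → σ) =>
        (TensorTrain.uniform L n G α β).eval (fun i => Fin.append s t (i.cast h.symm))).rank ≤ r :=
  TensorTrain.rank_unfolding_uniform_le_of_vecMul_chainProd G α β (k + 1) m h Y
    (fun s => (α ᵥ* TensorTrain.chainProd G k (Fin.init s)) ᵥ* X (s (Fin.last k))) fun s => by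
      rw [TensorTrain.chainProd, hG, Matrix.vecMul_vecMul, Matrix.vecMul_vecMul]

/-- A RIGHT FACTORISATION BOUNDS AN UNFOLDING RANK (column version): if the boundary column swept
back through the last `m` cores always lies in the column space of a fixed `n × r` matrix `Z`,
`G_k(t₀) ⋯ G_{k+m-1}(t_{m-1}) · β = Z · w(t)`, the unfolding matrix across the bond before site
`k` has rank `≤ r`.  [cite: KazeevKhoromskij2012, Thm. 4.1] -/
theorem TensorTrain.rank_unfolding_uniform_le_of_chainProd_mulVec {n r L : ℕ}
    (G : ℕ → σ → Matrix (Fin n) (Fin n) K) (α β : Fin n → K) (k m : ℕ) (h : k + m = L)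
    (Z : Matrix (Fin n) (Fin r) K) (w : (Fin m → σ) → Fin r → K)
    (hw : ∀ t, TensorTrain.chainProd (fun ℓ => G (k + ℓ)) m t *ᵥ β = Z *ᵥ w t) :
    (Matrix.of fun (s : Fin k → σ) (t : Fin m → σ) =>
        (TensorTrain.uniform L n G α β).eval (fun i => Fin.append s t (i.cast h.symm))).rank ≤
      r := by
  classical
  let P : Matrix (Fin k → σ) (Fin n) K :=
    Matrix.of fun s l => (α ᵥ* TensorTrain.chainProd G k s) l
  let Q : Matrix (Fin r) (Fin m → σ) K := Matrix.of fun i t => w t i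
  have hPQ : (Matrix.of fun (s : Fin k → σ) (t : Fin m → σ) =>
      (TensorTrain.uniform L n G α β).eval (fun i => Fin.append s t (i.cast h.symm))) =
        P * (Z * Q) := by
    have hr : ∀ t : Fin m → σ,
        (Matrix.of fun l j => (TensorTrain.uniform L n G α β).segProd k m t l
            (j.cast (congrArg (TensorTrain.uniform L n G α β).r h).symm)) *ᵥ
          (TensorTrain.uniform L n G α β).rbdry = Z *ᵥ w t := by
      intro t
      rw [← hw t, ← TensorTrain.segProd_uniform L G α β k m t]
      rfl
    ext s t
    rw [Matrix.of_apply, TensorTrain.eval_append_eq_sum_bond _ k m h s t, Matrix.mul_apply, hr t,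
      TensorTrain.leftProd_uniform]
    rfl
  rw [hPQ]
  calc (P * (Z * Q)).rank ≤ (Z * Q).rank := Matrix.rank_mul_le_right _ _
    _ ≤ Z.rank := Matrix.rank_mul_le_left _ _
    _ ≤ Fintype.card (Fin r) := Matrix.rank_le_card_width Z
    _ = r := Fintype.card_fin r

/-- THEOREM 4.1 (line `Δ_DD^{(d₁…d_D)}`), THE `4`s: every unfolding matrix of the assembled QTT
Laplacian has rank `≤ 4`.  [cite: KazeevKhoromskij2012, Thm. 4.1] -/
theorem rank_unfolding_lapMultiTrain_le (a : ℕ → K) (D d k m : ℕ) (h : k + m = D * d) :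
    (Matrix.of fun (s : Fin k → Fin 2 × Fin 2) (t : Fin m → Fin 2 × Fin 2) =>
        (lapMultiTrain K a D d).eval (fun i => Fin.append s t (i.cast h.symm))).rank ≤ 4 :=
  TensorTrain.rank_unfolding_le _ k m h

/-- THEOREM 4.1 (line `Δ_DD^{(d₁…d_D)}`), THE `2`s: across the bond following the last site of a
dimension (a junction site `ℓ ≡ d - 1 (mod d)`, whose core `supLast a_k ⋈ E` factors through the
rank-2 bond) the unfolding matrix has rank `≤ 2`.  [cite: KazeevKhoromskij2012, Thm. 4.1] -/
theorem rank_unfolding_lapMultiTrain_junction_le (a : ℕ → K) (D d ℓ m : ℕ) (hℓ : ℓ % d = d - 1)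
    (h : ℓ + 1 + m = D * d) :
    (Matrix.of fun (s : Fin (ℓ + 1) → Fin 2 × Fin 2) (t : Fin m → Fin 2 × Fin 2) =>
        (lapMultiTrain K a D d).eval (fun i => Fin.append s t (i.cast h.symm))).rank ≤ 2 :=
  TensorTrain.rank_unfolding_uniform_le_of_core_eq_mul _ _ _ ℓ m h
    (fun p => lapSupCore K p * supR K (a (ℓ / d))) (supL K) fun p => by
      show (if ℓ % d = d - 1 then _ else _) = _
      rw [if_pos hℓ, lapJunction, supLast_eq]

/-- THEOREM 4.1 (line `Δ_DD^{(d₁…d_D)}`), THE LEADING `3`s: across the bonds inside the first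
dimension (after `k < d` sites) the unfolding matrix has rank `≤ 3` — the boundary row
`(1, 0, 0, 0)` never excites the fourth channel, so the states `supVec 1 0` live in the three
Laplace channels of Lem. 2.1 (the second display of Cor. 2.4).
[cite: KazeevKhoromskij2012, Thm. 4.1] -/
theorem rank_unfolding_lapMultiTrain_head_le (a : ℕ → K) (D d k m : ℕ) (hk : k < d)
    (h : k + m = D * d) :
    (Matrix.of fun (s : Fin k → Fin 2 × Fin 2) (t : Fin m → Fin 2 × Fin 2) =>
        (lapMultiTrain K a D d).eval (fun i => Fin.append s t (i.cast h.symm))).rank ≤ 3 := by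
  refine TensorTrain.rank_unfolding_uniform_le_of_vecMul_chainProd _ _ _ k m h
    (!![1, 0, 0, 0; 0, 1, 0, 0; 0, 0, 1, 0] : Matrix (Fin 3) (Fin 4) K)
    (fun s =>
      ![supVec K 1 0 (quanticsEquiv 2 k fun r => (s r).1) (quanticsEquiv 2 k fun r => (s r).2) 0,
        supVec K 1 0 (quanticsEquiv 2 k fun r => (s r).1) (quanticsEquiv 2 k fun r => (s r).2) 1,
        supVec K 1 0 (quanticsEquiv 2 k fun r => (s r).1) (quanticsEquiv 2 k fun r => (s r).2) 2])
    fun s => ?_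
  have hcongr : TensorTrain.chainProd
        (fun ℓ p => if ℓ % d = d - 1 then lapJunction K (a (ℓ / d)) p else lapSupCore K p) k s =
      TensorTrain.chainProd (fun _ => lapSupCore K) k (fun r => ((s r).1, (s r).2)) :=
    TensorTrain.chainProd_congr (fun ℓ hℓ p => by
      show (if ℓ % d = d - 1 then _ else _) = _
      rw [Nat.mod_eq_of_lt (by omega), if_neg (by omega)]) s
  rw [hcongr, vecMul_chainProd_lapSupCore]
  ext j
  fin_cases j <;> simp [supVec, Matrix.vecMul, dotProduct, Fin.sum_univ_three]

/-- The `4 × 3` matrix `[1 1 2c; 1 0 0; 0 1 0; 0 0 1]` through which the last column state of the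
assembled train factors (`(2cI - cJ - cJ', -cJ, -cJ', I)ᵀ = Z₃(c) · (-cJ, -cJ', I)ᵀ`).
[cite: KazeevKhoromskij2012, Thm. 4.1] -/
def lastZ (c : K) : Matrix (Fin 4) (Fin 3) K :=
  !![1, 1, 2 * c; 1, 0, 0; 0, 1, 0; 0, 0, 1]

/-- [folklore] The column state entering the last site factors through `lastZ` (bookkeeping). -/
private theorem lapJunction_mulVec (c : K) (p : Fin 2 × Fin 2) :
    (lapSupCore K p * supR K c * supL K) *ᵥ ![0, 0, 0, 1] =
      lastZ c *ᵥ ![-c * blkJ K p, -c * blkJ' K p, blkI K p] := by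
  ext i
  fin_cases i <;>
    simp [lapSupCore, supR, supL, lastZ, Matrix.mulVec, Matrix.mul_apply, dotProduct,
      Fin.sum_univ_four, Fin.sum_univ_two, Fin.sum_univ_three] <;> ring

/-- THEOREM 4.1 (line `Δ_DD^{(d₁…d_D)}`), THE TRAILING `3`: across the very last bond the unfolding
matrix has rank `≤ 3` (the `4 × 3` penultimate core of the third display of Cor. 2.4: the column
`(2cI - cJ - cJ', -cJ, -cJ', I)ᵀ` entering the last site spans only three directions).
[cite: KazeevKhoromskij2012, Thm. 4.1] -/
theorem rank_unfolding_lapMultiTrain_last_le (a : ℕ → K) (D d k : ℕ) (h : k + 1 = D * d) :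
    (Matrix.of fun (s : Fin k → Fin 2 × Fin 2) (t : Fin 1 → Fin 2 × Fin 2) =>
        (lapMultiTrain K a D d).eval (fun i => Fin.append s t (i.cast h.symm))).rank ≤ 3 := by
  have hd : d ≠ 0 := by
    rintro rfl
    simp at h
  obtain ⟨D', rfl⟩ : ∃ D', D = D' + 1 :=
    Nat.exists_eq_add_one_of_ne_zero (by rintro rfl; simp at h)
  have hk : k = D' * d + (d - 1) := by
    rw [Nat.succ_mul] at h
    omega
  have hkd : k % d = d - 1 := by
    rw [hk, site_mod D' d (d - 1) (by omega)]
  refine TensorTrain.rank_unfolding_uniform_le_of_chainProd_mulVec _ _ _ k 1 h (lastZ (a (k / d)))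
    (fun t => ![-a (k / d) * blkJ K (t (Fin.last 0)), -a (k / d) * blkJ' K (t (Fin.last 0)),
      blkI K (t (Fin.last 0))]) fun t => ?_
  rw [TensorTrain.chainProd, TensorTrain.chainProd, Matrix.one_mul, Nat.add_zero]
  show (if k % d = d - 1 then lapJunction K (a (k / d)) (t (Fin.last 0))
    else lapSupCore K (t (Fin.last 0))) *ᵥ _ = _
  rw [if_pos hkd, lapJunction, supLast_eq, lapJunction_mulVec]

end Ranks

end Literature.LinearAlgebra.TensorNetworks
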